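import Summits.ABC.ABC.Theses.DefiniteXi
import Summits.ABC.ABC.Theorems.DefiniteXiXiStrongBoundAllTamExp
import Literature.NumberTheory.EllipticCurves.CongruenceNumber
import HarnessLib

/-!
# STUB-IDEAS k1 · gen 37 — Plan R♯: `Sig`-pattern reshape of the line `p6_tamagawa_split`, registrable today

Crux `DefiniteXi.SteinbergCore` (stmt-ABC-15024); companion of `STUB-IDEAS-stub_xiDegreeComparison-1.md` (gen 37, §2 Δ3).
NOT registered by this seat (stub-ideation never touches the lead's skeleton) — it is the file a lead / the owner may
register with `ledger skeleton check … --crux stmt-ABC-15024` when executing the critic's Plan R (STUB-PLAN §2), in the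
`namespace Sig` shape of `run/shared/lean/playbooks/analytic-nt.md` §2 (one `def Sig.stub_X : Prop` per stub, header
`theorem stub_X : Sig.stub_X`, so a landed Theorems theorem closes a stub BY NAME with `:= <landed decl>`).

What changes relative to the registered skeleton (3 stubs):
* old stub 1 (`xiDegreeComparison`, known in print) is replaced by its two refereed INPUTS as stubs —
  `stub_oneSidedARSFrey` (= `StubIdeasK1G11.OneSidedARSFrey`, the one direction of ARS 2012 Thm 2.1(b) at `p ≥ 5` on Frey
  data; spelled out verbatim below) and `stub_freyModularity` (= the route item `DefiniteXi.FreyModularity`, stmt-ABC-11340,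
  BCDT) — plus the CONDITIONAL comparison `stub_xiOfInputs : OneSidedARSFrey → FreyModularity → ⟨old stub 1 verbatim⟩`,
  whose 0-sorry proof is `StubIdeasK1G36/…G11.stub_xiDegreeComparison_of_oneSidedARSFrey` in the crux-dir certificate
  `STUB_PLAN_stub_xiDegreeComparison_XiMono.lean` (2 917 lines, rc 0; lands as Theorems/DefiniteXiSteinbergCoreXi1…Xi10 per
  STUB-PLAN App. A) — so the certificate closes a REGISTERED stub by name instead of landing as credit-less helpers;
* stubs 2, 3 verbatim; the landed glue `steinbergCore_of_subs_frey` (p137293; module `DefiniteXiSteinbergCoreSplit` is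
  `remote:stale:…:unbuilt` on the farm today, rc 75) is INLINED as `glueFrey_inline`, and the T-child is converted by the
  built `Summit.ABC.ABC.Theorems.stub_allTamExp_of_valuationProduct`; `SteinbergCore_of` concludes the crux BY NAME.
Expected audit: 5 stubs, sorries = 5 (only inside `stub_*`), 0 elsewhere.  Disproof honoured: `steinbergCore_false_without_eps_pos`
(`0 < ε` is spent inside the certificate's L3 prime choice, i.e. inside `stub_xiOfInputs`).
-/

set_option linter.dupNamespace false

namespace Summit.ABC.ABC.Cruxes.SteinbergCore.P6TamagawaSplitRSharp

open Literature.NumberTheory.EllipticCurves Literature.NumberTheory.Automorphic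
open Literature.NumberTheory.EllipticCurves.ModularForms

noncomputable section

namespace Sig

/-- Statement of the OLD stub 1 (child `XiDegreeComparison`, verbatim): the definite comparison away from `6` with slack.
Not a stub of this reshaped line — it is the conclusion of `stub_xiOfInputs`. [cite: AgasheRibetStein2012, Thm. 2.1; shape only] -/
def xiDegreeComparison : Prop :=
    ∀ ε : ℝ, 0 < ε → ∃ C : ℝ, ∀ a b : ℤ, IsCoprime a b → a * b * (a + b) ≠ 0 → ∀ (N : ℕ) [NeZero N],
      (Literature.NumberTheory.EllipticCurves.freyCurve a b).conductorNorm ℤ = N →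
      ∀ Nm : ℕ, Odd Nm → Squarefree Nm → Odd Nm.primeFactors.card → Nm ∣ N →
      Literature.NumberTheory.Automorphic.brandtXi (N / Nm) Nm
          (fun n => (Literature.NumberTheory.EllipticCurves.freyCurve a b).LFunction n) ≠ 0 →
      ∃ D : Literature.NumberTheory.EllipticCurves.ModularForms.ModularParametrizationData
        (Literature.NumberTheory.EllipticCurves.freyCurve a b) N,
        (∀ D' : Literature.NumberTheory.EllipticCurves.ModularForms.ModularParametrizationData
          (Literature.NumberTheory.EllipticCurves.freyCurve a b) N, D.deg ≤ D'.deg) ∧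
        ((Literature.NumberTheory.Automorphic.brandtXi (N / Nm) Nm
              (fun n => (Literature.NumberTheory.EllipticCurves.freyCurve a b).LFunction n) /
            (ordProj[2] (Literature.NumberTheory.Automorphic.brandtXi (N / Nm) Nm
                (fun n => (Literature.NumberTheory.EllipticCurves.freyCurve a b).LFunction n)) *
              ordProj[3] (Literature.NumberTheory.Automorphic.brandtXi (N / Nm) Nm
                (fun n => (Literature.NumberTheory.EllipticCurves.freyCurve a b).LFunction n))) : ℕ) : ℝ) ≤
          C * (N : ℝ) ^ ε * ((D.deg / (ordProj[2] D.deg * ordProj[3] D.deg) : ℕ) : ℝ) *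
            ((∏ q ∈ N.primeFactors, ((Literature.NumberTheory.EllipticCurves.freyCurve a b).minimalDiscriminantNorm
              ℤ).factorization q : ℕ) : ℝ) ^ 3

/-- Statement of `stub_oneSidedARSFrey` — INPUT 1 (= `StubIdeasK1G11.OneSidedARSFrey` verbatim): for coprime `a, b`,
`N = N(E_(a,b))`, every modular parametrisation datum `D` of `E_(a,b)` at level `N` and every prime `p ≥ 5`,
`ord_p(r_{D.f}) ≤ ord_p(deg φ_D)` — the one direction of ARS Thm 2.1(b) the comparison consumes (`p ∥ N` for `p ≥ 5 ∣ abc`,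
so `p² ∤ N`).  Follows from the tree's named fact `padicValNat_congruenceNumber_eq_of_not_sq_dvd` (certificate helper 8,
`oneSidedARSFrey_of_facts`). [cite: AgasheRibetStein2012, Thm. 2.1(b)] -/
def stub_oneSidedARSFrey : Prop :=
  ∀ (a b : ℤ), IsCoprime a b → a * b * (a + b) ≠ 0 →
    ∀ (N : ℕ) [NeZero N], (freyCurve a b).conductorNorm ℤ = N →
    ∀ (D : ModularParametrizationData (freyCurve a b) N) (p : ℕ), p.Prime → 5 ≤ p →
      padicValNat p (congruenceNumber D.f) ≤ padicValNat p D.modularDegree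

/-- Statement of `stub_freyModularity` — INPUT 2: the route's own item `DefiniteXi.FreyModularity` (stmt-ABC-11340; in the
tree `Summit.ABC.ABC.Theorems.freyModularity_of_CDT_theorem_7_1_2' : BCDT.CDT_theorem_7_1_2 → FreyModularity`).
[cite: BreuilConradDiamondTaylor2001, Thm. A] -/
def stub_freyModularity : Prop := Summit.ABC.ABC.Theses.DefiniteXi.FreyModularity

/-- Statement of `stub_xiOfInputs` — the comparison CONDITIONAL on its two inputs (the theta-lattice congruence transfer
`cps ξ ≤ 4 C₃ N^ε · cps r_f` + ARS one direction + minimal datum from modularity; 0-sorry certificate in the crux dir,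
`stub_xiDegreeComparison_of_oneSidedARSFrey`). [folklore] -/
def stub_xiOfInputs : Prop := stub_oneSidedARSFrey → stub_freyModularity → xiDegreeComparison

/-- Statement of `stub_primeToSixDegreeBound` (verbatim stub 2; child `PrimeToSixDegreeBound`, the abc-strength atom).
[cite: Frey1987, degree conjecture; shape only] -/
def stub_primeToSixDegreeBound : Prop :=
    ∀ ε : ℝ, 0 < ε → ∃ C : ℝ, ∀ a b : ℤ, IsCoprime a b → a * b * (a + b) ≠ 0 → ∀ (N : ℕ) [NeZero N],
      (Literature.NumberTheory.EllipticCurves.freyCurve a b).conductorNorm ℤ = N →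
      ∀ D : Literature.NumberTheory.EllipticCurves.ModularForms.ModularParametrizationData
        (Literature.NumberTheory.EllipticCurves.freyCurve a b) N,
        (∀ D' : Literature.NumberTheory.EllipticCurves.ModularForms.ModularParametrizationData
          (Literature.NumberTheory.EllipticCurves.freyCurve a b) N, D.deg ≤ D'.deg) →
        ((D.deg / (ordProj[2] D.deg * ordProj[3] D.deg) : ℕ) : ℝ) ≤ C * (N : ℝ) ^ (2 + ε)

/-- Statement of `stub_abcValuationProduct` (verbatim stub 3 = stmt-ABC-1567 `AbcValuationProduct`). [folklore] -/
def stub_abcValuationProduct : Prop :=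
    ∀ ε : ℝ, 0 < ε → ∃ K : ℝ, ∀ a b c : ℕ, Literature.NumberTheory.DiophantineGeometry.IsABCTriple a b c →
      ((∏ p ∈ (a * b * c).primeFactors, (a * b * c).factorization p : ℕ) : ℝ) ≤
        K * ((Literature.NumberTheory.DiophantineGeometry.rad a b c : ℕ) : ℝ) ^ ε

end Sig

/-- STUB (INPUT 1) — one-sided ARS 2.1(b) at `p ≥ 5` on Frey data (cite-only today; N1′ programme if proved). -/
theorem stub_oneSidedARSFrey : Sig.stub_oneSidedARSFrey := by
  sorry

/-- STUB (INPUT 2) — modularity of the Frey curve with an optimal datum (route item stmt-ABC-11340). -/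
theorem stub_freyModularity : Sig.stub_freyModularity := by
  sorry

/-- STUB (COMPARISON GIVEN INPUTS) — proved in the crux-dir certificate; closes by name once Xi1–Xi10 land:
`:= fun hF hMod => Summit.ABC.ABC.Theorems.SteinbergCoreXi.StubIdeasK1G11.stub_xiDegreeComparison_of_oneSidedARSFrey hF hMod`. -/
theorem stub_xiOfInputs : Sig.stub_xiOfInputs := by
  sorry

/-- STUB (P6) — verbatim stub 2 of the registered line. -/
theorem stub_primeToSixDegreeBound : Sig.stub_primeToSixDegreeBound := by
  sorry

/-- STUB (T) — verbatim stub 3 of the registered line (stmt-ABC-1567). -/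
theorem stub_abcValuationProduct : Sig.stub_abcValuationProduct := by
  sorry

/-- **Inlined landed glue** (verbatim the proof of `Summit.ABC.ABC.Theorems.steinbergCore_of_subs_frey`,
Theorems/DefiniteXiSteinbergCoreSplit.lean, p137293; copied here only because that module is unbuilt on the farm). -/
theorem glueFrey_inline
    (hC : ∀ ε : ℝ, 0 < ε → ∃ C : ℝ, ∀ a b : ℤ, IsCoprime a b → a * b * (a + b) ≠ 0 → ∀ (N : ℕ) [NeZero N],
      (Literature.NumberTheory.EllipticCurves.freyCurve a b).conductorNorm ℤ = N →
      ∀ Nm : ℕ, Odd Nm → Squarefree Nm → Odd Nm.primeFactors.card → Nm ∣ N →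
      Literature.NumberTheory.Automorphic.brandtXi (N / Nm) Nm
          (fun n => (Literature.NumberTheory.EllipticCurves.freyCurve a b).LFunction n) ≠ 0 →
      ∃ D : Literature.NumberTheory.EllipticCurves.ModularForms.ModularParametrizationData
        (Literature.NumberTheory.EllipticCurves.freyCurve a b) N,
        (∀ D' : Literature.NumberTheory.EllipticCurves.ModularForms.ModularParametrizationData
          (Literature.NumberTheory.EllipticCurves.freyCurve a b) N, D.deg ≤ D'.deg) ∧
        ((Literature.NumberTheory.Automorphic.brandtXi (N / Nm) Nm
              (fun n => (Literature.NumberTheory.EllipticCurves.freyCurve a b).LFunction n) /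
            (ordProj[2] (Literature.NumberTheory.Automorphic.brandtXi (N / Nm) Nm
                (fun n => (Literature.NumberTheory.EllipticCurves.freyCurve a b).LFunction n)) *
              ordProj[3] (Literature.NumberTheory.Automorphic.brandtXi (N / Nm) Nm
                (fun n => (Literature.NumberTheory.EllipticCurves.freyCurve a b).LFunction n))) : ℕ) : ℝ) ≤
          C * (N : ℝ) ^ ε * ((D.deg / (ordProj[2] D.deg * ordProj[3] D.deg) : ℕ) : ℝ) *
            ((∏ q ∈ N.primeFactors, ((Literature.NumberTheory.EllipticCurves.freyCurve a b).minimalDiscriminantNorm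
              ℤ).factorization q : ℕ) : ℝ) ^ 3)
    (hP : ∀ ε : ℝ, 0 < ε → ∃ C : ℝ, ∀ a b : ℤ, IsCoprime a b → a * b * (a + b) ≠ 0 → ∀ (N : ℕ) [NeZero N],
      (Literature.NumberTheory.EllipticCurves.freyCurve a b).conductorNorm ℤ = N →
      ∀ D : Literature.NumberTheory.EllipticCurves.ModularForms.ModularParametrizationData
        (Literature.NumberTheory.EllipticCurves.freyCurve a b) N,
        (∀ D' : Literature.NumberTheory.EllipticCurves.ModularForms.ModularParametrizationData
          (Literature.NumberTheory.EllipticCurves.freyCurve a b) N, D.deg ≤ D'.deg) →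
        ((D.deg / (ordProj[2] D.deg * ordProj[3] D.deg) : ℕ) : ℝ) ≤ C * (N : ℝ) ^ (2 + ε))
    (hT : ∀ ε : ℝ, 0 < ε → ∃ C : ℝ, ∀ a b : ℤ, IsCoprime a b → a * b * (a + b) ≠ 0 → ∀ (N : ℕ) [NeZero N],
      (Literature.NumberTheory.EllipticCurves.freyCurve a b).conductorNorm ℤ = N →
      ((∏ q ∈ N.primeFactors, ((Literature.NumberTheory.EllipticCurves.freyCurve a b).minimalDiscriminantNorm
        ℤ).factorization q : ℕ) : ℝ) ≤ C * (N : ℝ) ^ ε) :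
    Summit.ABC.ABC.Theses.DefiniteXi.SteinbergCore := by
  intro ε hε
  obtain ⟨C₀, hC₀⟩ := hC (ε / 4) (by linarith)
  obtain ⟨C₁, hC₁⟩ := hP (ε / 4) (by linarith)
  obtain ⟨C₂, hC₂⟩ := hT (ε / 8) (by linarith)
  refine ⟨max C₀ 0 * max C₁ 0 * max C₂ 0 ^ 4, ?_⟩
  intro a b hab h0 N _ hN Nm hodd hsq hcard hdvd
  have hNpos : (0 : ℝ) < (N : ℝ) := by exact_mod_cast Nat.pos_of_ne_zero (NeZero.ne N)
  set ξ : ℕ := brandtXi (N / Nm) Nm (fun n => (freyCurve a b).LFunction n) with hξ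
  set T : ℕ := ∏ q ∈ N.primeFactors, ((freyCurve a b).minimalDiscriminantNorm ℤ).factorization q with hTdef
  -- exponent bookkeeping: `N^(ε/4) · N^(2 + ε/4) · (N^(ε/8))⁴ = N^(2+ε)`
  have hfour : ((N : ℝ) ^ (ε / 8)) ^ (4 : ℕ) = (N : ℝ) ^ (ε / 2) := by
    rw [← Real.rpow_natCast ((N : ℝ) ^ (ε / 8)) 4, ← Real.rpow_mul hNpos.le]
    congr 1
    push_cast
    ring
  have hsplit : (N : ℝ) ^ (ε / 4) * (N : ℝ) ^ (2 + ε / 4) * ((N : ℝ) ^ (ε / 8)) ^ (4 : ℕ) =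
      (N : ℝ) ^ (2 + ε) := by
    rw [hfour, ← Real.rpow_add hNpos, ← Real.rpow_add hNpos]
    ring_nf
  have hRHS0 : (0 : ℝ) ≤ max C₀ 0 * max C₁ 0 * max C₂ 0 ^ 4 * (N : ℝ) ^ (2 + ε) := by positivity
  have hT0 : (0 : ℝ) ≤ (T : ℝ) := by positivity
  have hTle : (T : ℝ) ≤ max C₂ 0 * (N : ℝ) ^ (ε / 8) := by
    refine (hC₂ a b hab h0 N hN).trans ?_
    exact mul_le_mul_of_nonneg_right (le_max_left _ _) (by positivity)
  by_cases hξ0 : ξ = 0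
  · -- junk branch: no eigen-line (`ξ = 0`), the left side vanishes
    have : ξ / (ordProj[2] ξ * ordProj[3] ξ) = 0 := by rw [hξ0, Nat.zero_div]
    rw [this]
    simpa using hRHS0
  · obtain ⟨D, hDmin, hcmp⟩ := hC₀ a b hab h0 N hN Nm hodd hsq hcard hdvd hξ0
    have hP' : ((D.deg / (ordProj[2] D.deg * ordProj[3] D.deg) : ℕ) : ℝ) ≤
        max C₁ 0 * (N : ℝ) ^ (2 + ε / 4) :=
      (hC₁ a b hab h0 N hN D hDmin).trans
        (mul_le_mul_of_nonneg_right (le_max_left _ _) (by positivity))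
    have hcmp' : ((ξ / (ordProj[2] ξ * ordProj[3] ξ) : ℕ) : ℝ) ≤
        max C₀ 0 * (N : ℝ) ^ (ε / 4) * ((D.deg / (ordProj[2] D.deg * ordProj[3] D.deg) : ℕ) : ℝ) *
          (T : ℝ) ^ 3 := by
      refine hcmp.trans ?_
      have h1 : (0 : ℝ) ≤ (N : ℝ) ^ (ε / 4) * ((D.deg / (ordProj[2] D.deg * ordProj[3] D.deg) : ℕ) : ℝ) *
          (T : ℝ) ^ 3 := by positivity
      calc C₀ * (N : ℝ) ^ (ε / 4) * ((D.deg / (ordProj[2] D.deg * ordProj[3] D.deg) : ℕ) : ℝ) * (T : ℝ) ^ 3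
          = C₀ * ((N : ℝ) ^ (ε / 4) * ((D.deg / (ordProj[2] D.deg * ordProj[3] D.deg) : ℕ) : ℝ) *
              (T : ℝ) ^ 3) := by ring
        _ ≤ max C₀ 0 * ((N : ℝ) ^ (ε / 4) * ((D.deg / (ordProj[2] D.deg * ordProj[3] D.deg) : ℕ) : ℝ) *
              (T : ℝ) ^ 3) := mul_le_mul_of_nonneg_right (le_max_left _ _) h1
        _ = _ := by ring
    calc ((ξ / (ordProj[2] ξ * ordProj[3] ξ) : ℕ) : ℝ) * (T : ℝ)
        ≤ (max C₀ 0 * (N : ℝ) ^ (ε / 4) * ((D.deg / (ordProj[2] D.deg * ordProj[3] D.deg) : ℕ) : ℝ) *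
            (T : ℝ) ^ 3) * (T : ℝ) := mul_le_mul_of_nonneg_right hcmp' hT0
      _ = max C₀ 0 * (N : ℝ) ^ (ε / 4) * ((D.deg / (ordProj[2] D.deg * ordProj[3] D.deg) : ℕ) : ℝ) *
            (T : ℝ) ^ (4 : ℕ) := by ring
      _ ≤ max C₀ 0 * (N : ℝ) ^ (ε / 4) * (max C₁ 0 * (N : ℝ) ^ (2 + ε / 4)) *
            (max C₂ 0 * (N : ℝ) ^ (ε / 8)) ^ (4 : ℕ) := by
          gcongr
      _ = max C₀ 0 * max C₁ 0 * max C₂ 0 ^ 4 *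
            ((N : ℝ) ^ (ε / 4) * (N : ℝ) ^ (2 + ε / 4) * ((N : ℝ) ^ (ε / 8)) ^ (4 : ℕ)) := by ring
      _ = max C₀ 0 * max C₁ 0 * max C₂ 0 ^ 4 * (N : ℝ) ^ (2 + ε) := by rw [hsplit]

/-- **Composition (Plan R♯)**: the five stub statements give the crux BY NAME — inputs feed the conditional comparison,
then the inlined landed glue and the built `stub_allTamExp_of_valuationProduct`. [folklore] -/
theorem SteinbergCore_of :
    Sig.stub_oneSidedARSFrey → Sig.stub_freyModularity → Sig.stub_xiOfInputs →
    Sig.stub_primeToSixDegreeBound → Sig.stub_abcValuationProduct →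
    Summit.ABC.ABC.Theses.DefiniteXi.SteinbergCore :=
  fun hF hMod hXi hP hAVP =>
    glueFrey_inline (hXi hF hMod) hP (Summit.ABC.ABC.Theorems.stub_allTamExp_of_valuationProduct hAVP)

/-- The crux from the stubs. -/
theorem steinbergCore : Summit.ABC.ABC.Theses.DefiniteXi.SteinbergCore :=
  SteinbergCore_of stub_oneSidedARSFrey stub_freyModularity stub_xiOfInputs stub_primeToSixDegreeBound
    stub_abcValuationProduct

end

end Summit.ABC.ABC.Cruxes.SteinbergCore.P6TamagawaSplitRSharp
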